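import Summits.QuantumFields.YangMills.Theorems.UnitScaleTiltProp7KernelFormOfOrthonormalBasis
import Summits.QuantumFields.YangMills.Theorems.UnitScaleTiltProp7IMSFirstOrderBlockCommutator
import Summits.QuantumFields.YangMills.Theorems.UnitScaleTiltProp7SiteEntryCoordinates
import Summits.QuantumFields.YangMills.Theorems.UnitScaleTiltProp7CoarseLipschitzTdist
import HarnessLib

/-!
# Route `UnitScaleTilt`, crux K1 «MinimiserStabilityRegPr» (stmt-QuantumFields-19200), EX row `hGF` (curved member), the LOD line, slot (L6) `hK₂`, piece (K2b) —
# **THE MEMBER KNIT OF THE `[P, χ]` FAMILY ROW: `Σ_c ‖R(N₂,c y) − N₂,c(R y)‖² ≤ (2ℓ²S₁² + 8ε²S₀²)·‖y‖²` FROM A BLOCK KERNEL BOUND OF `1 − R` IN THE SPIKE BASIS**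

Cell `ym3-torus` (HUMAN RULING D-0037: YM₃ on T³ is ladder rung R3 — NOT d = 4, NOT infinite volume, NOT a mass gap, NOT Clay).  Width seat `ym3-torus-px10` (gen 10); w5 g13
2026-08-30 01:27Z: «(K2b) member knit OPEN».  THEOREMS ONLY (0 `def`, 0 `sorry`); `--supports stmt-QuantumFields-19200 --as helper`, count-neutral.  HONEST LABEL (★★OWNER RULING
№33 (6)): linear-algebra knit of LANDED rows; CONDITIONAL on the block kernel bound `hA` and its moments `hS0`∕`hS1` (hypotheses — at the member they are routeR-w2 g12's
✓`Prop7ComplementaryProjectorBlockDecay.kernelMatrix_blockBound_of_regPr` and ✓`…BlockDecayKnit` §5); nothing of (3.49), Thm 3.11, `hK₂`, `hT`, `hGF`, EX or the crux is proved here.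

THE CONSUMER.  ✓`Prop7LODSlotK2.hK2_of_rows` (w5 g13, p754590) discharges the knit's `hK₂` from four sub-rows; (K2a) `hKD` is ✓`Prop7CutoffCommutatorFamily.sum_normSq_Dstar_comm_le_of_dock`
(px17 g8), (K2d)∕(K2e) are ★p1's ✓`normSq_adjoint_le_normSq_projR_add` and w7's curvature floor; the remaining one is
`hKP : ∀ y, Σ_j ‖projR (covLapSite F n K c₀ U₀) QU (N₂ j y) − N₂ j (projR (covLapSite F n K c₀ U₀) QU y)‖² ≤ κP²·‖y‖²`, `J := Site (F.P K) 0`, `N₂ j` the site cut-offs of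
✓`Prop7LODCutoffDock.exists_LOD_cutoffs[_corner]` (reading `(toL2S)⁻¹(N₂ j φ) x = χ_j x • (toL2S)⁻¹ φ x`).  THIS FILE proves it for ANY linear `R` on the site `L²` space whose complement
`1 − R` has a BLOCK KERNEL BOUND in px17's site⊗entry spike basis — the hypothesis `hA` below is, token for token, the `hA` binder of the IMS cores ✓`Prop7IMSDoubleCommutatorPerturbedBlock` ∕
✓`Prop7IMSFirstOrderBlockCommutator` and the CONCLUSION of routeR-w2's B6 `kernelMatrix_blockBound[_of_regPr]` at `R := projR (covLapSite F n K c₀ U₀) Q''` — so the assembler docks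
by `exact`.

THE MATHEMATICS ([Balaban1985BackgroundPropagators] Thm 3.11 p. 416 with (3.49) p. 399 and the partitions (3.100) pp. 413–414; B. Simon's IMS localisation).  Write `P := 1 − R` and
`[R, χ_c] = −[P, χ_c]`.  In the orthonormal spike basis `b_F` (✓`orthonormal_spike`, index `i = (x,(j,k))`) the cut-off `N₂,c` is DIAGONAL with the REAL entry `χ_c(x)` (its `toL2S`
reading), so w5's dictionary ✓`Prop7KernelFormOfOrthonormalBasis.normSq_comm_eq_sum_kernel` turns `‖P(N₂,c y) − N₂,c(P y)‖²` into the kernel-form commutator of the matrix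
`A i k = ⟪b_F i, P(b_F k)⟫` with the multiplier `h_c(i) = χ_c(i.1)`; splitting `h_c = g_c ∘ blk + δ_c` at the block corners (`g_c X := χ_c(corner X)`, `blk i := iterBlockOf (K−n) i.1`)
the first-order IMS core ✓`sum_normSq_comm_le_of_blockBound_perturbed` bounds the family sum by `(2ℓ²S₁² + 8ε²S₀²)·Σ_i ‖ŷ_i‖² = (…)·‖y‖²` (Parseval), where `ℓ²`, `ε²` are the
coarse-Lipschitz and in-block-oscillation budgets of the partition: `hLip` with `dc := tdist` for ALL block pairs is ✓`Prop7CoarseLipschitzTdist.sum_sq_corner_sub_corner_le`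
(`ℓ² = (L^{K−n})²·ℓ_f²`) and `hδ` is px17's ✓`Prop7LODCutoffBlockSplit.sum_sq_sub_corner_le` (`ε² = (d(L^{K−n} − 1))²·ℓ_f²`); at the (L6-χ) family `ℓ_f² = 2880∕(L^sL^{K−n})²`:
`ℓ² = 2880∕L^{2s}`, `ε² ≤ 25920∕L^{2s}` — K- and volume-free.

WHAT IS PROVED (ns `…Theorems.Prop7LODSlotK2Member`).
* §1 (generic, any complex inner-product space with an orthonormal basis `b`): `inner_diag_symm` (a `b`-diagonal operator with real entries is symmetric), `norm_comm_compl_eq`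
  (`‖(1 − R)(N y) − N((1 − R)y)‖ = ‖R(N y) − N(R y)‖` for additive `N`).
* §2 (member letters): `spike_symm_apply_eq_zero_of_ne` (the spike `b_F (x,jk)` reads as a site function supported at `x`), ★`diag_of_siteReading` (a site cut-off with the
  `toL2S` reading is `b_F`-diagonal with entries `χ(i.1)`).
* §3 ★★★ `sum_normSq_comm_le_of_kernelBlockBound` — THE KNIT, hypothesis form on (`hA`, `hS0`, `hS1`), for any finite real family `χ_c` with the univ-form per-step family budget
  `Σ_c (χ_c(x + e_μ) − χ_c x)² ≤ ℓ_f²` (the dock shape of ✓`sum_re_inner_DeltaEta_cutoffOps_le` ∕ ✓`sum_normSq_Dstar_comm_le_of_dock`) and any linear `N₂ c` with the site reading: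
  `∀ y, Σ_c ‖R (N₂ c y) − N₂ c (R y)‖² ≤ (2·((L^{K−n})²ℓ_f²)·S₁² + 8·((d(L^{K−n} − 1))²ℓ_f²)·S₀²)·‖y‖²` = `hKP` with `κP := √(…)`.
HONEST SCOPE.  Bookkeeping over landed rows; the kernel bound and its moments are displayed hypotheses (supplied at the member by routeR-w2's B5∕B6, CONDITIONAL on their window∕gap);
the positivity of the knit's `γ_LOD` is the assembler's numeric window and is NOT touched here.

References: T. Bałaban, CMP **99** (1985) 389–434 [Balaban1985BackgroundPropagators] (Thm 3.11 p.416, (3.49) p.399, (3.100) pp.413–414); CMP **95** (1984) 17–40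
[Balaban1984PropagatorsI] ((1.18)–(1.20) p.20); B. Simon, Ann. IHP A **38** (1983) 295–308.
-/

set_option autoImplicit false

noncomputable section

open scoped InnerProductSpace ComplexConjugate BigOperators Matrix

namespace Summit.QuantumFields.YangMills.Theorems.Prop7LODSlotK2Member

open Literature.MathematicalPhysics.QuantumFieldTheory.Balaban1983to89
open Literature.MathematicalPhysics.QuantumFieldTheory.Balaban1983to89.T3ContinuumYM3Torus
open Finset
open B5Eq118OneStroke (iterBlockOf)
open B11Eq103H1Complex (SiteL2K)
open Summit.QuantumFields.YangMills.Theorems.Prop7SectET3Transport (periodsT3)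
open Summit.QuantumFields.YangMills.Theorems.Prop7SectET3HilbertLetters (W₂ toL2S)
open Summit.QuantumFields.YangMills.Theorems.Prop7SiteEntryCoordinates (orthonormal_spike top_le_span_spike toMatrixOrthonormal_apply_eq_inner)
open Summit.QuantumFields.YangMills.Theorems.Prop7KernelFormOfOrthonormalBasis (normSq_eq_sum_normSq_inner normSq_comm_eq_sum_kernel)
open Summit.QuantumFields.YangMills.Theorems.Prop7IMSFirstOrderBlockCommutator (sum_normSq_comm_le_of_blockBound_perturbed)
open Summit.QuantumFields.YangMills.Theorems.Prop7CoarseLipschitzTdist (sum_sq_corner_sub_corner_le)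
open Summit.QuantumFields.YangMills.Theorems.Prop7LODCutoffBlockSplit (sum_sq_sub_corner_le)
open B3Taylor310LocalRemainder (tdist_comm)

/-! ## §1 Generic: real-diagonal operators are symmetric; the complement trick -/

section Generic

variable {E : Type*} [NormedAddCommGroup E] [InnerProductSpace ℂ E] {m : Type*} [Fintype m]

/-- A `b`-diagonal operator with REAL entries is symmetric: `H (b i) = h_i • b i` ⟹ `⟪H x, y⟫ = ⟪x, H y⟫`. [folklore] -/
theorem inner_diag_symm (b : OrthonormalBasis m ℂ E) (H : E →ₗ[ℂ] E) (h : m → ℝ) (hH : ∀ i, H (b i) = ((h i : ℝ) : ℂ) • b i)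
    (x y : E) : ⟪H x, y⟫_ℂ = ⟪x, H y⟫_ℂ := by
  have hHx : ∀ z : E, H z = ∑ i, (⟪b i, z⟫_ℂ * ((h i : ℝ) : ℂ)) • b i := by
    intro z
    conv_lhs => rw [← b.sum_repr' z]
    rw [map_sum]
    refine Finset.sum_congr rfl fun i _ => ?_
    rw [map_smul, hH, smul_smul]
  rw [hHx x, hHx y, sum_inner, inner_sum]
  refine Finset.sum_congr rfl fun i _ => ?_
  rw [inner_smul_left, inner_smul_right, map_mul, Complex.conj_ofReal, ← inner_conj_symm x (b i)]
  ring

/-- For an additive `N` and `P = 1 − R`: `‖P(N y) − N(P y)‖ = ‖R(N y) − N(R y)‖` (`[1 − R, N] = −[R, N]`). [folklore] -/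
theorem norm_comm_compl_eq (R : E →ₗ[ℂ] E) (N : E →ₗ[ℂ] E) (y : E) :
    ‖(LinearMap.id - R : E →ₗ[ℂ] E) (N y) - N ((LinearMap.id - R : E →ₗ[ℂ] E) y)‖ = ‖R (N y) - N (R y)‖ := by
  rw [LinearMap.sub_apply, LinearMap.sub_apply, LinearMap.id_apply, LinearMap.id_apply, map_sub, ← norm_neg]
  congr 1
  abel

end Generic

/-! ## §2 Member letters: spikes read as one-site functions; site cut-offs are spike-diagonal -/

section Member

variable (F : T3Family) {K : ℕ} {c₀ : ℝ} [Fact (0 < c₀)]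

/-- The spike `b_F (x,(j,k)) = (√c₀)⁻¹·toL2S(δ_x⊗E_{jk})` READS AS A SITE FUNCTION SUPPORTED AT `x`: `(toL2S)⁻¹(b_F i) x′ = 0` for `x′ ≠ i.1`. [cite: Balaban1985BackgroundPropagators, (3.11) p.392] -/
theorem spike_symm_apply_eq_zero_of_ne (i : Site (F.P K) 0 × (Fin 2 × Fin 2)) (x : Site (F.P K) 0) (hx : x ≠ i.1) :
    (toL2S F K c₀).symm ((OrthonormalBasis.mk (orthonormal_spike F) (top_le_span_spike F) :
      OrthonormalBasis (Site (F.P K) 0 × (Fin 2 × Fin 2)) ℂ (SiteL2K ℂ 3 (periodsT3 F K) c₀ W₂)) i) x = 0 := by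
  rw [OrthonormalBasis.coe_mk, map_smul, LinearEquiv.symm_apply_apply, Pi.smul_apply, Pi.single_eq_of_ne hx, smul_zero]

/-- ★ **A SITE CUT-OFF IS SPIKE-DIAGONAL WITH REAL ENTRIES**: if `(toL2S)⁻¹(N φ) x = χ x • (toL2S)⁻¹ φ x` for all `φ, x` (the reading of ✓`Prop7LODCutoffDock.exists_LOD_cutoffs`), then
`N (b_F i) = χ(i.1) • b_F i`. [cite: Balaban1985BackgroundPropagators, (3.11) p.392, (3.100) pp.413-414] -/
theorem diag_of_siteReading (χ : Site (F.P K) 0 → ℝ) (N : SiteL2K ℂ 3 (periodsT3 F K) c₀ W₂ →ₗ[ℂ] SiteL2K ℂ 3 (periodsT3 F K) c₀ W₂)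
    (hN : ∀ (φ : SiteL2K ℂ 3 (periodsT3 F K) c₀ W₂) (x : Site (F.P K) 0), (toL2S F K c₀).symm (N φ) x = χ x • (toL2S F K c₀).symm φ x)
    (i : Site (F.P K) 0 × (Fin 2 × Fin 2)) :
    N ((OrthonormalBasis.mk (orthonormal_spike F) (top_le_span_spike F) :
        OrthonormalBasis (Site (F.P K) 0 × (Fin 2 × Fin 2)) ℂ (SiteL2K ℂ 3 (periodsT3 F K) c₀ W₂)) i)
      = ((χ i.1 : ℝ) : ℂ) • (OrthonormalBasis.mk (orthonormal_spike F) (top_le_span_spike F) :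
        OrthonormalBasis (Site (F.P K) 0 × (Fin 2 × Fin 2)) ℂ (SiteL2K ℂ 3 (periodsT3 F K) c₀ W₂)) i := by
  apply (toL2S F K c₀).symm.injective
  funext x
  rw [hN, map_smul, Pi.smul_apply]
  by_cases hx : x = i.1
  · rw [hx]
    ext j k
    simp only [Matrix.smul_apply, Complex.real_smul, smul_eq_mul]
  · rw [spike_symm_apply_eq_zero_of_ne F i x hx, smul_zero, smul_zero]

end Member

/-! ## §3 ★★★ The knit -/

section Knit

variable (F : T3Family) (n K : ℕ) (c₀ : ℝ) [Fact (0 < c₀)]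

/-- ★★★ **(K2b) THE MEMBER KNIT OF THE `[P, χ]` FAMILY ROW — `hKP` OF ✓`Prop7LODSlotK2.hK2_of_rows`, HYPOTHESIS FORM ON THE KERNEL OF `1 − R`.**
Data: any linear `R` on the site `L²` space; a block kernel bound `hA` of the matrix of `1 − R` in px17's spike basis over the `(K−n)`-blocks (`blk i := iterBlockOf (K−n) i.1`) with a symmetric
nonnegative `βb` whose row sums and first `tdist`-moments are `≤ S₀`, `≤ S₁` (the IMS cores' `hA`∕`hS0`∕`hS1` letters VERBATIM; at the member: routeR-w2's ✓`kernelMatrix_blockBound_of_regPr`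
and ✓`…BlockDecayKnit` §5); a finite real family `χ_c` with the univ-form per-step family budget `Σ_c (χ_c(x+e_μ) − χ_c x)² ≤ ℓ_f²`; linear maps `N₂ c` with the site reading of
✓`exists_LOD_cutoffs`.  Conclusion: `∀ y, Σ_c ‖R(N₂ c y) − N₂ c(R y)‖² ≤ (2·((L^{K−n})²·ℓ_f²)·S₁² + 8·((d·(L^{K−n} − 1))²·ℓ_f²)·S₀²)·‖y‖²`.
[cite: Balaban1985BackgroundPropagators, Thm 3.11 p.416, (3.49) p.399, (3.100) pp.413-414; Balaban1984PropagatorsI, (1.18)-(1.20) p.20] -/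
theorem sum_normSq_comm_le_of_kernelBlockBound
    (R : SiteL2K ℂ 3 (periodsT3 F K) c₀ W₂ →ₗ[ℂ] SiteL2K ℂ 3 (periodsT3 F K) c₀ W₂)
    (βb : Site (F.P K) (K - n) → Site (F.P K) (K - n) → ℝ) (hβs : ∀ X Y, βb X Y = βb Y X) (hβ0 : ∀ X Y, 0 ≤ βb X Y)
    {S₀ S₁ : ℝ} (hS₀ : 0 ≤ S₀) (hS₁ : 0 ≤ S₁)
    (hA : ∀ (X Y : Site (F.P K) (K - n)) (u w : Site (F.P K) 0 × (Fin 2 × Fin 2) → ℂ),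
      ‖∑ i ∈ Finset.univ.filter (fun i : Site (F.P K) 0 × (Fin 2 × Fin 2) => iterBlockOf (K - n) i.1 = X),
          ∑ k ∈ Finset.univ.filter (fun k : Site (F.P K) 0 × (Fin 2 × Fin 2) => iterBlockOf (K - n) k.1 = Y),
            star (u i) * LinearMap.toMatrixOrthonormal (OrthonormalBasis.mk (orthonormal_spike F) (top_le_span_spike F) :
              OrthonormalBasis (Site (F.P K) 0 × (Fin 2 × Fin 2)) ℂ (SiteL2K ℂ 3 (periodsT3 F K) c₀ W₂)) (LinearMap.id - R) i k * w k‖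
        ≤ βb X Y * Real.sqrt (∑ i ∈ Finset.univ.filter (fun i : Site (F.P K) 0 × (Fin 2 × Fin 2) => iterBlockOf (K - n) i.1 = X), ‖u i‖ ^ 2)
          * Real.sqrt (∑ k ∈ Finset.univ.filter (fun k : Site (F.P K) 0 × (Fin 2 × Fin 2) => iterBlockOf (K - n) k.1 = Y), ‖w k‖ ^ 2))
    (hS0 : ∀ X, ∑ Y, βb X Y ≤ S₀) (hS1 : ∀ X, ∑ Y, (Site.tdist X Y : ℝ) * βb X Y ≤ S₁)
    {ι : Type*} [Fintype ι] (χ : ι → Site (F.P K) 0 → ℝ) {ℓf2 : ℝ}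
    (hfam : ∀ (x : Site (F.P K) 0) (μ : Fin (F.P K).d), ∑ c, (χ c (x.shift μ) - χ c x) ^ 2 ≤ ℓf2)
    (N₂ : ι → (SiteL2K ℂ 3 (periodsT3 F K) c₀ W₂ →ₗ[ℂ] SiteL2K ℂ 3 (periodsT3 F K) c₀ W₂))
    (hN : ∀ (c : ι) (φ : SiteL2K ℂ 3 (periodsT3 F K) c₀ W₂) (x : Site (F.P K) 0), (toL2S F K c₀).symm (N₂ c φ) x = χ c x • (toL2S F K c₀).symm φ x) :
    ∀ y : SiteL2K ℂ 3 (periodsT3 F K) c₀ W₂,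
      ∑ c, ‖R (N₂ c y) - N₂ c (R y)‖ ^ 2
        ≤ (2 * (((F.L : ℝ) ^ (K - n)) ^ 2 * ℓf2) * S₁ ^ 2 + 8 * ((((F.P K).d : ℝ) * ((F.L : ℝ) ^ (K - n) - 1)) ^ 2 * ℓf2) * S₀ ^ 2) * ‖y‖ ^ 2 := by
  classical
  intro y
  -- letters
  set bF : OrthonormalBasis (Site (F.P K) 0 × (Fin 2 × Fin 2)) ℂ (SiteL2K ℂ 3 (periodsT3 F K) c₀ W₂) :=
    OrthonormalBasis.mk (orthonormal_spike F) (top_le_span_spike F) with hbF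
  set P : SiteL2K ℂ 3 (periodsT3 F K) c₀ W₂ →ₗ[ℂ] SiteL2K ℂ 3 (periodsT3 F K) c₀ W₂ := LinearMap.id - R with hP
  set A : Matrix (Site (F.P K) 0 × (Fin 2 × Fin 2)) (Site (F.P K) 0 × (Fin 2 × Fin 2)) ℂ := Matrix.of fun i k => ⟪bF i, P (bF k)⟫_ℂ with hAdef
  set blk : Site (F.P K) 0 × (Fin 2 × Fin 2) → Site (F.P K) (K - n) := fun i => iterBlockOf (K - n) i.1 with hblk
  set corner : Site (F.P K) (K - n) → Site (F.P K) 0 := fun Y => Site.fibreSite 0 (K - n) Y fun _ => ⟨0, pow_pos (F.P K).L_pos (K - n)⟩ with hcorner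
  set g : ι → Site (F.P K) (K - n) → ℝ := fun c X => χ c (corner X) with hg
  set δ : ι → Site (F.P K) 0 × (Fin 2 × Fin 2) → ℝ := fun c i => χ c i.1 - χ c (corner (blk i)) with hδ
  set v : Site (F.P K) 0 × (Fin 2 × Fin 2) → ℂ := fun k => ⟪bF k, y⟫_ℂ with hv
  have hk : K - n ≤ (F.P K).m + (F.P K).K := by show K - n ≤ F.m + K; omega
  have hℓf : 0 ≤ ℓf2 := (Finset.sum_nonneg fun c _ => sq_nonneg _).trans (hfam (0 : Site (F.P K) 0) ⟨0, by rw [T3Family.P_d]; omega⟩)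
  have hLL : ((F.P K).L : ℝ) = F.L := rfl
  -- the multipliers split at the corners: `χ c i.1 = g c (blk i) + δ c i`
  have hsplit : ∀ c i, ((χ c i.1 : ℝ) : ℂ) = ((g c (blk i) + δ c i : ℝ) : ℂ) := fun c i => by rw [hg, hδ]; push_cast; ring
  -- (1) each commutator in kernel form
  have hker : ∀ c, ‖R (N₂ c y) - N₂ c (R y)‖ ^ 2
      = ∑ i, ‖(A *ᵥ (fun k => ((g c (blk k) + δ c k : ℝ) : ℂ) * v k)) i - ((g c (blk i) + δ c i : ℝ) : ℂ) * (A *ᵥ v) i‖ ^ 2 := by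
    intro c
    have hH : ∀ i, N₂ c (bF i) = ((χ c i.1 : ℝ) : ℂ) • bF i := fun i => by rw [hbF]; exact diag_of_siteReading F (χ c) (N₂ c) (hN c) i
    have hHsym := inner_diag_symm bF (N₂ c) (fun i => χ c i.1) hH
    rw [← norm_comm_compl_eq R (N₂ c) y, ← hP, normSq_comm_eq_sum_kernel bF P (N₂ c) (fun i => χ c i.1) hH hHsym y]
    refine Finset.sum_congr rfl fun i _ => ?_
    simp only [hsplit, hAdef, hv]
  -- (2) the core's hypotheses
  have hA' : ∀ (X Y : Site (F.P K) (K - n)) (u w : Site (F.P K) 0 × (Fin 2 × Fin 2) → ℂ),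
      ‖∑ i ∈ univ.filter (fun i => blk i = X), ∑ k ∈ univ.filter (fun k => blk k = Y), star (u i) * A i k * w k‖
        ≤ βb X Y * Real.sqrt (∑ i ∈ univ.filter (fun i => blk i = X), ‖u i‖ ^ 2) * Real.sqrt (∑ k ∈ univ.filter (fun k => blk k = Y), ‖w k‖ ^ 2) := by
    intro X Y u w
    have h := hA X Y u w
    simp only [toMatrixOrthonormal_apply_eq_inner] at h
    simpa only [hAdef, Matrix.of_apply, hblk, hbF, hP] using h
  have hLip : ∀ X Y : Site (F.P K) (K - n), ∑ c, (g c X - g c Y) ^ 2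
      ≤ (Real.sqrt (((F.L : ℝ) ^ (K - n)) ^ 2 * ℓf2)) ^ 2 * (Site.tdist X Y : ℝ) ^ 2 := by
    intro X Y
    rw [Real.sq_sqrt (by positivity)]
    have h := sum_sq_corner_sub_corner_le (P := F.P K) hk Finset.univ χ hℓf hfam X Y
    rw [hLL] at h
    simpa only [hg, hcorner] using h
  have hδ' : ∀ i : Site (F.P K) 0 × (Fin 2 × Fin 2), ∑ c, δ c i ^ 2
      ≤ (Real.sqrt ((((F.P K).d : ℝ) * ((F.L : ℝ) ^ (K - n) - 1)) ^ 2 * ℓf2)) ^ 2 := by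
    intro i
    rw [Real.sq_sqrt (by positivity)]
    have h := sum_sq_sub_corner_le (P := F.P K) hk Finset.univ χ hℓf hfam i.1
    rw [hLL] at h
    simpa only [hδ, hcorner, hblk] using h
  have hdcs : ∀ X Y : Site (F.P K) (K - n), (Site.tdist X Y : ℝ) = (Site.tdist Y X : ℝ) := fun X Y => by rw [tdist_comm]
  have hdc0 : ∀ X Y : Site (F.P K) (K - n), (0 : ℝ) ≤ (Site.tdist X Y : ℝ) := fun X Y => Nat.cast_nonneg _
  -- (3) the core
  have hcore := sum_normSq_comm_le_of_blockBound_perturbed A blk g δ (fun X Y => (Site.tdist X Y : ℝ)) βb hβs hβ0 hdcs hdc0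
    (Real.sqrt_nonneg _) hS₀ hS₁ hLip hδ' hA' hS0 hS1 v
  rw [Real.sq_sqrt (by positivity), Real.sq_sqrt (by positivity)] at hcore
  -- (4) Parseval and assembly
  have hpars : ∑ i, ‖v i‖ ^ 2 = ‖y‖ ^ 2 := by rw [hv, ← normSq_eq_sum_normSq_inner bF y]
  calc ∑ c, ‖R (N₂ c y) - N₂ c (R y)‖ ^ 2
      = ∑ c, ∑ i, ‖(A *ᵥ (fun k => ((g c (blk k) + δ c k : ℝ) : ℂ) * v k)) i - ((g c (blk i) + δ c i : ℝ) : ℂ) * (A *ᵥ v) i‖ ^ 2 :=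
        Finset.sum_congr rfl fun c _ => hker c
    _ ≤ (2 * (((F.L : ℝ) ^ (K - n)) ^ 2 * ℓf2) * S₁ ^ 2 + 8 * ((((F.P K).d : ℝ) * ((F.L : ℝ) ^ (K - n) - 1)) ^ 2 * ℓf2) * S₀ ^ 2) * ∑ i, ‖v i‖ ^ 2 := hcore
    _ = _ := by rw [hpars]

end Knit

end Summit.QuantumFields.YangMills.Theorems.Prop7LODSlotK2Member

end
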